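import Literature.Analysis.FluidPDE.Tao2016AveragedNS.SplitCascadeRescaledWindowCert
import HarnessLib

/-!
# The split Prop. 6.5: an explicit bound for the window level (input of the assembly's `n₀`-largeness)

T. Tao, *Finite time blowup for an averaged three-dimensional Navier–Stokes equation*,
arXiv:1402.0290v3, §6.4 Prop. 6.5 (regime `1 ≪ 1/ε₀ ≪ K ≪ 1/ε ≪ n₀`); Grönwall
[`HairerNorsettWanner1993`, §I.10].
HONEST FRAMING: statements about the SPLIT cascade model system; nothing here proves the split
Prop. 6.5 and nothing here concerns the true Navier–Stokes equations.

`windowLevel ε₀ K ε C₁ n₀ η` (`SplitCascadeRescaledWindowCert.lean`) is a nested `gronwallBound`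
expression. For the assembly one needs it in the form "linear in `η²` and in `(C₁(1+ε₀)^{-n₀/2})²`
with coefficients depending on `(ε, K)` only": from `gronwallBound δ r s x ≤ e^{rx}(δ + s/r)`
(`r > 0`, `s, x ≥ 0`),
`windowLevel² ≤ A(ε,K)·η² + B(ε,K)·(C₁(1+ε₀)^{-n₀/2})²` with
`A = 4e^{100r'} + 1152ε⁻⁴e^{100r}(1 + e^{100r'})`, `B = 128(e^{100r}(1+1152ε⁻⁴… ))…` — we state
the bound with the explicit expressions `Awin ε K`, `Bwin ε K` below. Consequently the master
smallness `16K⁵(1+ε₀)²(ε⁻²+ε⁻¹K¹⁰+K+1)·windowLevel² ≤ (C₁/2)(1+ε₀)^{-n₀/2}` holds as soon as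
`η² ≤ (1+ε₀)^{-n₀/2}`, `C₁ ≥ 64K⁵(1+ε₀)²(ε⁻²+ε⁻¹K¹⁰+K+1)·Awin` and
`64K⁵(1+ε₀)²(ε⁻²+ε⁻¹K¹⁰+K+1)·Bwin·C₁·(1+ε₀)^{-n₀/2} ≤ 1` (`windowLevel_small`).

## References

* T. Tao, arXiv:1402.0290v3, §6.4 Prop. 6.5. [`Tao2016AveragedNS`]
* E. Hairer, S. P. Nørsett, G. Wanner, *Solving ODE I*, §I.10. [`HairerNorsettWanner1993`]
-/

noncomputable section

open Real

namespace Literature.Analysis.FluidPDE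

namespace Tao2016AveragedNS

/-- `gronwallBound δ r s x ≤ e^{rx}(δ + s/r)` for `r > 0`, `s ≥ 0`, `x ≥ 0`.
[cite: HairerNorsettWanner1993, §I.10] -/
theorem gronwallBound_le_exp_mul {δ r s x : ℝ} (hr : 0 < r) (hs : 0 ≤ s) (hx : 0 ≤ x) :
    gronwallBound δ r s x ≤ Real.exp (r * x) * (δ + s / r) := by
  rw [gronwallBound_of_K_ne_0 hr.ne']
  have h1 : 0 ≤ s / r := div_nonneg hs hr.le
  have h2 : 1 ≤ Real.exp (r * x) := Real.one_le_exp (mul_nonneg hr.le hx)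
  nlinarith

/-- The `η²`-coefficient of the window-level bound (depends on `ε, K` only).
[cite: Tao2016AveragedNS, §6.4 Prop. 6.5] -/
def Awin (ε K : ℝ) : ℝ :=
  2 * Real.exp ((24 * (ε⁻¹ * K ^ 10) + 1) * 100) +
    2 * Real.exp ((2 * (12 * ε + 12 * ε ^ 2 + 72 * K) + 1) * 100) *
      (2 + 2 * (2 * (12 * (ε ^ 2)⁻¹) ^ 2 * Real.exp ((24 * (ε⁻¹ * K ^ 10) + 1) * 100)))

/-- The `(C₁δ)²`-coefficient of the window-level bound (depends on `ε, K` only).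
[cite: Tao2016AveragedNS, §6.4 Prop. 6.5] -/
def Bwin (ε K : ℝ) : ℝ :=
  2 * Real.exp ((24 * (ε⁻¹ * K ^ 10) + 1) * 100) * 64 +
    2 * Real.exp ((2 * (12 * ε + 12 * ε ^ 2 + 72 * K) + 1) * 100) *
      (2 * (2 * 64 + 2 * (12 * (ε ^ 2)⁻¹) ^ 2 * (Real.exp ((24 * (ε⁻¹ * K ^ 10) + 1) * 100) * 64)))

/-- **The window level is linear in `η²` and `(C₁(1+ε₀)^{-n₀/2})²`**:
`windowLevel ε₀ K ε C₁ n₀ η ² ≤ Awin ε K · η² + Bwin ε K · (C₁(1+ε₀)^{-n₀/2})²`.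
[cite: Tao2016AveragedNS, §6.4 Prop. 6.5] -/
theorem windowLevel_sq_le {ε₀ K ε C₁ : ℝ} {n₀ : ℤ} {η : ℝ} (hε₀ : -1 < ε₀) (hε : 0 < ε) (hK : 0 ≤ K) :
    windowLevel ε₀ K ε C₁ n₀ η ^ 2 ≤
      Awin ε K * η ^ 2 + Bwin ε K * (C₁ * (1 + ε₀) ^ (-(n₀ : ℝ) / 2)) ^ 2 := by
  have h0 : (0 : ℝ) < 1 + ε₀ := by linarith
  set d : ℝ := C₁ * (1 + ε₀) ^ (-(n₀ : ℝ) / 2) with hd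
  set r : ℝ := 24 * (ε⁻¹ * K ^ 10) + 1 with hr
  set r' : ℝ := 2 * (12 * ε + 12 * ε ^ 2 + 72 * K) + 1 with hr'
  have hr0 : 0 < r := by positivity
  have hr'0 : 0 < r' := by positivity
  have hr1 : 1 ≤ r := by
    have : 0 ≤ 24 * (ε⁻¹ * K ^ 10) := by positivity
    rw [hr]; linarith
  have hr'1 : 1 ≤ r' := by
    have : 0 ≤ 2 * (12 * ε + 12 * ε ^ 2 + 72 * K) := by positivity
    rw [hr']; linarith
  set E : ℝ := Real.exp (r * 100) with hE
  set E' : ℝ := Real.exp (r' * 100) with hE'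
  have hE1 : 1 ≤ E := Real.one_le_exp (by positivity)
  have hE'1 : 1 ≤ E' := Real.one_le_exp (by positivity)
  -- the `c`-channel level
  set Lc : ℝ := windowLevelC ε₀ K ε C₁ n₀ η with hLc
  have hLc_le : Lc ≤ E * (η ^ 2 + (8 * d) ^ 2) := by
    have h1 : Lc ≤ Real.exp (r * 100) * (η ^ 2 + (8 * d) ^ 2 / r) := by
      rw [hLc]; unfold windowLevelC
      have := gronwallBound_le_exp_mul (δ := η ^ 2) hr0 (sq_nonneg (8 * C₁ * (1 + ε₀) ^ (-(n₀ : ℝ) / 2)))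
        (by norm_num : (0 : ℝ) ≤ 100)
      rw [hd]; convert this using 3; ring
    have h2 : (8 * d) ^ 2 / r ≤ (8 * d) ^ 2 := div_le_self (sq_nonneg _) hr1
    have hE0 : 0 ≤ E := by linarith
    calc Lc ≤ E * (η ^ 2 + (8 * d) ^ 2 / r) := h1
      _ ≤ E * (η ^ 2 + (8 * d) ^ 2) := mul_le_mul_of_nonneg_left (by linarith) hE0
  have hLc0 : 0 ≤ Lc := by
    rw [hLc]; unfold windowLevelC
    exact gronwallBound_nonneg' hr0 (sq_nonneg _) (sq_nonneg _) (by norm_num)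
  -- the `(a,d)`-channel level
  set Lad : ℝ := windowLevelAD ε₀ K ε C₁ n₀ η with hLad
  have hG : (8 * C₁ * (1 + ε₀) ^ (-(n₀ : ℝ) / 2) + 12 * (ε ^ 2)⁻¹ * Real.sqrt Lc) ^ 2 ≤
      2 * (8 * d) ^ 2 + 2 * (12 * (ε ^ 2)⁻¹) ^ 2 * Lc := by
    have e : 8 * C₁ * (1 + ε₀) ^ (-(n₀ : ℝ) / 2) = 8 * d := by rw [hd]; ring
    rw [e]
    have hsq : Real.sqrt Lc ^ 2 = Lc := Real.sq_sqrt hLc0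
    nlinarith [sq_nonneg (8 * d - 12 * (ε ^ 2)⁻¹ * Real.sqrt Lc), hsq]
  have hLad_le : Lad ≤ E' * (2 * η ^ 2 + 2 * (2 * (8 * d) ^ 2 + 2 * (12 * (ε ^ 2)⁻¹) ^ 2 * Lc)) := by
    have h1 : Lad ≤ Real.exp (r' * 100) * (2 * η ^ 2 +
        2 * (8 * C₁ * (1 + ε₀) ^ (-(n₀ : ℝ) / 2) + 12 * (ε ^ 2)⁻¹ * Real.sqrt Lc) ^ 2 / r') := by
      rw [hLad]; unfold windowLevelAD; rw [← hLc]
      exact gronwallBound_le_exp_mul hr'0 (by positivity) (by norm_num)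
    have h2 : 2 * (8 * C₁ * (1 + ε₀) ^ (-(n₀ : ℝ) / 2) + 12 * (ε ^ 2)⁻¹ * Real.sqrt Lc) ^ 2 / r' ≤
        2 * (2 * (8 * d) ^ 2 + 2 * (12 * (ε ^ 2)⁻¹) ^ 2 * Lc) :=
      (div_le_self (by positivity) hr'1).trans (by linarith)
    have hE'0 : 0 ≤ E' := by linarith
    exact h1.trans (mul_le_mul_of_nonneg_left (by linarith) hE'0)
  have hLad0 : 0 ≤ Lad := by
    rw [hLad]; unfold windowLevelAD
    exact gronwallBound_nonneg' hr'0 (by positivity) (by positivity) (by norm_num)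
  -- `(√Lc + √Lad)² ≤ 2(Lc + Lad)`
  have hwl : windowLevel ε₀ K ε C₁ n₀ η ^ 2 ≤ 2 * (Lc + Lad) := by
    unfold windowLevel; rw [← hLc, ← hLad]
    have a := Real.sq_sqrt hLc0
    have b := Real.sq_sqrt hLad0
    nlinarith [sq_nonneg (Real.sqrt Lc - Real.sqrt Lad)]
  -- combine
  have hη2 : 0 ≤ η ^ 2 := sq_nonneg _
  have hd2 : 0 ≤ d ^ 2 := sq_nonneg _
  have hE0 : 0 ≤ E := by linarith
  have hE'0 : 0 ≤ E' := by linarith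
  have hfin : 2 * (Lc + Lad) ≤ Awin ε K * η ^ 2 + Bwin ε K * d ^ 2 := by
    have hLc' : Lc ≤ E * η ^ 2 + E * 64 * d ^ 2 := by nlinarith [hLc_le]
    have hLad' : Lad ≤ E' * (2 * η ^ 2 + 2 * (2 * 64 * d ^ 2 + 2 * (12 * (ε ^ 2)⁻¹) ^ 2 *
        (E * η ^ 2 + E * 64 * d ^ 2))) := by
      refine hLad_le.trans (mul_le_mul_of_nonneg_left ?_ hE'0)
      have hc : 0 ≤ 2 * (12 * (ε ^ 2)⁻¹) ^ 2 := by positivity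
      nlinarith [mul_le_mul_of_nonneg_left hLc' hc]
    unfold Awin Bwin
    rw [← hr, ← hr', ← hE, ← hE']
    nlinarith [hLc', hLad', hη2, hd2, hE0, hE'0]
  exact hwl.trans hfin

/-- **The master smallness of the window from three simple conditions**: if `η² ≤ (1+ε₀)^{-n₀/2}`,
`64K⁵(1+ε₀)²(ε⁻²+ε⁻¹K¹⁰+K+1)·Awin ≤ C₁` and `64K⁵(1+ε₀)²(ε⁻²+ε⁻¹K¹⁰+K+1)·Bwin·C₁·(1+ε₀)^{-n₀/2} ≤ 1`,
then `16K⁵(1+ε₀)²(ε⁻²+ε⁻¹K¹⁰+K+1)·windowLevel² ≤ (C₁/2)(1+ε₀)^{-n₀/2}`.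
[cite: Tao2016AveragedNS, §6.4 Prop. 6.5] -/
theorem windowLevel_small {ε₀ K ε C₁ : ℝ} {n₀ : ℤ} {η : ℝ} (hε₀ : 0 < ε₀) (hε : 0 < ε) (hK : 0 ≤ K)
    (hC₁ : 0 ≤ C₁) (hη : η ^ 2 ≤ (1 + ε₀) ^ (-(n₀ : ℝ) / 2))
    (hA : 64 * (K ^ 5 * (1 + ε₀) ^ (2 : ℝ)) * ((ε ^ 2)⁻¹ + ε⁻¹ * K ^ 10 + K + 1) * Awin ε K ≤ C₁)
    (hB : 64 * (K ^ 5 * (1 + ε₀) ^ (2 : ℝ)) * ((ε ^ 2)⁻¹ + ε⁻¹ * K ^ 10 + K + 1) * Bwin ε K * C₁ *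
      (1 + ε₀) ^ (-(n₀ : ℝ) / 2) ≤ 1) :
    16 * (K ^ 5 * (1 + ε₀) ^ (2 : ℝ)) * ((ε ^ 2)⁻¹ + ε⁻¹ * K ^ 10 + K + 1) *
        windowLevel ε₀ K ε C₁ n₀ η ^ 2 ≤ C₁ / 2 * (1 + ε₀) ^ (-(n₀ : ℝ) / 2) := by
  have h0 : (0 : ℝ) < 1 + ε₀ := by linarith
  set δ : ℝ := (1 + ε₀) ^ (-(n₀ : ℝ) / 2) with hδ
  have hδ0 : 0 < δ := Real.rpow_pos_of_pos h0 _
  set P : ℝ := (K ^ 5 * (1 + ε₀) ^ (2 : ℝ)) * ((ε ^ 2)⁻¹ + ε⁻¹ * K ^ 10 + K + 1) with hP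
  have hP0 : 0 ≤ P := by positivity
  have hw := windowLevel_sq_le (C₁ := C₁) (n₀ := n₀) (η := η) (by linarith : (-1 : ℝ) < ε₀) hε hK
  rw [← hδ] at hw
  have hA0 : 0 ≤ Awin ε K := by unfold Awin; positivity
  have hB0 : 0 ≤ Bwin ε K := by unfold Bwin; positivity
  -- `16 P (A η² + B C₁² δ²) ≤ 16 P A δ + 16 P B C₁² δ² ≤ (C₁/4) δ + (C₁/4) δ`
  have h1 : 16 * P * (Awin ε K * η ^ 2) ≤ C₁ / 4 * δ := by
    have : 16 * P * Awin ε K * η ^ 2 ≤ 16 * P * Awin ε K * δ :=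
      mul_le_mul_of_nonneg_left hη (by positivity)
    have hA' : 16 * P * Awin ε K ≤ C₁ / 4 := by
      have e : 16 * P * Awin ε K =
          (64 * (K ^ 5 * (1 + ε₀) ^ (2 : ℝ)) * ((ε ^ 2)⁻¹ + ε⁻¹ * K ^ 10 + K + 1) * Awin ε K) / 4 := by
        rw [hP]; ring
      rw [e]; linarith
    nlinarith [mul_le_mul_of_nonneg_right hA' hδ0.le]
  have h2 : 16 * P * (Bwin ε K * (C₁ * δ) ^ 2) ≤ C₁ / 4 * δ := by
    have hB' : 64 * P * Bwin ε K * C₁ * δ ≤ 1 := by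
      calc 64 * P * Bwin ε K * C₁ * δ = 64 * (K ^ 5 * (1 + ε₀) ^ (2 : ℝ)) *
          ((ε ^ 2)⁻¹ + ε⁻¹ * K ^ 10 + K + 1) * Bwin ε K * C₁ * δ := by rw [hP]; ring
        _ ≤ 1 := hB
    have : 16 * P * (Bwin ε K * (C₁ * δ) ^ 2) = (64 * P * Bwin ε K * C₁ * δ) * (C₁ / 4 * δ) := by ring
    rw [this]
    have hq : 0 ≤ C₁ / 4 * δ := by positivity
    calc (64 * P * Bwin ε K * C₁ * δ) * (C₁ / 4 * δ) ≤ 1 * (C₁ / 4 * δ) :=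
          mul_le_mul_of_nonneg_right hB' hq
      _ = _ := one_mul _
  calc 16 * (K ^ 5 * (1 + ε₀) ^ (2 : ℝ)) * ((ε ^ 2)⁻¹ + ε⁻¹ * K ^ 10 + K + 1) *
        windowLevel ε₀ K ε C₁ n₀ η ^ 2 = 16 * P * windowLevel ε₀ K ε C₁ n₀ η ^ 2 := by rw [hP]; ring
    _ ≤ 16 * P * (Awin ε K * η ^ 2 + Bwin ε K * (C₁ * δ) ^ 2) := mul_le_mul_of_nonneg_left hw (by positivity)
    _ = 16 * P * (Awin ε K * η ^ 2) + 16 * P * (Bwin ε K * (C₁ * δ) ^ 2) := by ring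
    _ ≤ C₁ / 4 * δ + C₁ / 4 * δ := add_le_add h1 h2
    _ = C₁ / 2 * δ := by ring

end Tao2016AveragedNS

end Literature.Analysis.FluidPDE
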